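/-
Copyright (c) 2026 the pub-hodgecm-mathlib formalisation cell (harness21).  Prover seat hodgecm-mathlib-LH4-p19 (g3), req620 Track A «(D-RAM) FOUR-FRAME» squad
(STAGE-1b, row (2) of the piece `f_{T₊}`, the (β₂) road (R-36) «PURE-CELL LEDGER»; β₂ WORD #29 «p19: RAY BANDS»: the count socket of an OFF-ROW cone cell, where the depth
refinement `levelSetDep ⊊ levelSet` is proper), 2026-09-05.
-/
import Summits.HodgeConjecture.HodgeConjecture.Theorems.F0P3cDyRamConeCellCountSocketThree   -- ★ p863833 (this lineage, LH4-p19 (g2)): `ncard_eq_ncard_of_digit_fibration₂`, ★ HEAD-hi, the vocabulary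
import HarnessLib

/-!
# Crux `H413`, line LH4 «(D-RAM) FOUR-FRAME» — STAGE-1b, row (2), the (β₂) road (R-36) — «THE COUNT SOCKET OF AN OFF-ROW CONE CELL»: ★ p863833's three-way socket WITHOUT
# the cell letter `levelSetDep = levelSet`, the depth clause riding in the generator data instead

Cell `hodgecm-mathlib` (D-0151), FLOOR 0, crux item H413 = `stmt-HodgeConjecture-24833`, route of record `HCCMUnconditional`; squad F0∕P3c∕LH4; lane
`--supports stmt-HodgeConjecture-24833 --as helper` (count-neutral; pays NO tier-0 row).  THEOREMS ONLY (no `def`, no instance, no notation, no `sorry`, default heartbeats);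
★-only imports; states NO law; every mathematical input is a HYPOTHESIS; (β₂) stays a HYPOTHESIS.

WHY (β₂ WORD #29, LH4-p04 (g10) 2026-09-05T01:11:48Z «p19: RAY BANDS»: the (OFF) residue's band letters `hU_ray` ∕ `hD_ray` of ★ p863760 ∕ ★ p863936).  The two count sockets of
this lineage, ★ p863807 `…ConeCellCountSocket.cellDiff_eq_zero_of_fibration_reads` and ★ p863833 `…Three.cellDiff_eq_zero_of_fibration_reads₃`, take the cell letter
`hcell : levelSetDep ρ Θ α (jE ϖ) h j b (lam − jE u) = levelSet ρ Θ α (jE ϖ) h j b` — paid below the row by ★ `…ConeCellLedgerSizes.levelSetDep_eq_levelSet_of_add_le` (`2b ≤ m`)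
and on the low diagonal by ★ `…ConeCellDiagonalSize.levelSetDep_diag_eq_levelSet` (`2j ≤ m`).  On the OFF-ROW cells of the upper line (`m < 2b`, `j + m = jl + b`; the sockets
`hUlo` ∕ `hDlo` of ★ p863352) the depth clause `μ·Λ^♯ ⊆ Λ` (★ DEFS `mem_levelSetDep_iff_isOrd_div`: `IsOrd ρ α cc (μ ∕ Y)`) is a GENUINE condition on the vertex — it cuts the
cell's digit shell down to a ball (this seat's RAYBANDS census) — so `hcell` is false there.  Nothing in the counting needs it: THIS FILE restates ★ p863833's HEAD with the depth
clause appended as a SIXTH conjunct of the generator data `GEN Λ x₀` in every letter ((hI) (hV) (hLit) (hF) (hP) (hL₁) (hL₂)), so that `levelSetDep(j, b; μ) = {Λ ∣ ∃ x₀, GEN Λ x₀}`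
on the nose (★ DEFS `mem_levelSetDep_iff`), and drops `hcell`.  The weight letter `hf` pins `f b j Λ` exactly on such `(Λ, x₀)` (its depth premise is the sixth conjunct), so the
reads (hP) ∕ (hL) stay provable from ★ p863859 letter for letter; the abstract count is ★ `ncard_eq_ncard_of_digit_fibration₂` unchanged (its `GEN` is arbitrary).
* HEAD `cellDiff_eq_zero_of_fibration_reads₄` — frame of ★ `…ConeCellFaceTubeAbove` VERBATIM + `hjiso` + `hfin` + the seven fibration letters and the three-way reads of ★ p863833
  with the six-conjunct `GEN`; conclusion = ★ p863833's (`cell = levelSetDep ρ Θ α (jE ϖ) h j b (lam − jE u)`, the ‹OFF›∕‹OFF_C› literal sums).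
HONEST LABEL.  Count-neutral bookkeeping; nothing printed is asserted; no census law is stated; `hU_ray`, `hD_ray`, `hL_ray` stay OPEN; `HC_CM` is proved only modulo the 7 printed
citations (2 remaining named inputs: hLiu418 = `stmt-HodgeConjecture-24832`, h413 = `stmt-HodgeConjecture-24833`) until rung 0 closes.
## References
* [Kottwitz1986BaseChangeUnits] R. E. Kottwitz, *Base change for unit elements of Hecke algebras*, Compositio Math. 60 (1986): §1 pp. 240–241 (fixed-lattice counts, cell by cell).
* [LabesseLanglands1979] J.-P. Labesse, R. P. Langlands, *L-indistinguishability for SL(2)*, Canad. J. Math. 31 (1979): §2 (2.2) p. 9 (κ-signed counts).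
* [Rogawski1990] J. D. Rogawski, *Automorphic Representations of Unitary Groups in Three Variables*, Ann. of Math. Stud. 123 (1990): §4.9 Prop. 4.9.1 (b) p. 55.
* [Jacobowitz1962] R. Jacobowitz, *Hermitian forms over local fields*, Amer. J. Math. 84 (1962): §4 (duals, modular components, gluing).
-/

set_option autoImplicit false

noncomputable section

namespace Summit.HodgeConjecture.HodgeConjecture.Cruxes.H413.F0P3cDyRamConeCellCountSocketDep

open scoped Valued WithZero Matrix MatrixGroups Classical
open WithZero Finset
open Literature.NumberTheory.Automorphic Literature.NumberTheory.Automorphic.HermitianLattice Literature.NumberTheory.Automorphic.UnitaryLatticeTree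
open Literature.NumberTheory.Automorphic.UnitaryThreeFourFrame (IsRamifiedQuadraticDatum)
open Summit.HodgeConjecture.HodgeConjecture.Cruxes.H413.F0P3cDyRamToricCensusDefs
open Summit.HodgeConjecture.HodgeConjecture.Cruxes.H413.F0P3cDyRamConeCellFaceTubeAbove (finsum_levelSetDep_inter_weight_eq_iff_of_le)
open Summit.HodgeConjecture.HodgeConjecture.Cruxes.H413.F0P3cDyRamConeCellCountSocketThree (ncard_eq_ncard_of_digit_fibration₂)

variable {E M : Type} [Field E] [Valued E ℤᵐ⁰] [Field M] [Valued M ℤᵐ⁰] {σ : E →+* E} {ρ Θ : M →+* M} {α : M}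

/-- **HEAD — «THE COUNT SOCKET OF AN OFF-ROW CONE CELL» (three-way reads, no `hcell`).**  Frame of ★ `…ConeCellFaceTubeAbove` VERBATIM (`σ hσ hvσ ϖ hϖ d t hD h2v H₂ hH₂σ hW hhW hhWσ jE
hρρ hvρ hα hα1 hint hΘΘ hΘρ hvΘ hΘj hjv hjfix hjpow hϖmax φ hφs hφi hφo γ₂ lam h hφγ hlam hΘh hh hform (u : E) b hb (hdb : d ≤ b) j (hlamj) f hf`) + `hjiso` + `hfin : (levelSet … j b).Finite` +
the fibration letters of ★ p863833 (`CLS Vf ε r Rd hRd2 hRd3 LIT NX ψ hI hV hLit hNX hψ hF hbase`) and its three-way reads (`P₁ Q₁ hP hL₁ hL₂`), ALL over the SIX-conjunct generator data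
`GEN Λ x₀ := x₀ ≠ 0 ∧ Λ = x₀·𝒪_j ∧ Y ∈ 𝒪_j ∧ Y∕ϖE ∉ 𝒪_j ∧ |Y| = |ϖE|^b ∧ (μ·Λ^♯ ⊆ Λ)` (the depth clause of ★ DEFS `levelSetDep` as the sixth conjunct).  THEN
`((Σᶠ_{Λ ∈ cell ∩ {P₁}} f b j Λ : ℕ) : ℤ) − ((Σᶠ_{Λ ∈ cell ∩ {Q₁}} f b j Λ : ℕ) : ℤ) = 0`, `cell = levelSetDep ρ Θ α (jE ϖ) h j b (lam − jE u)` — ★ p863833's conclusion, for cells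
where `levelSetDep ⊊ levelSet`. [cite: Kottwitz1986BaseChangeUnits, §1 pp. 240–241] [cite: LabesseLanglands1979, §2 (2.2) p. 9] [cite: Rogawski1990, §4.9 Prop. 4.9.1 (b) p. 55] -/
theorem cellDiff_eq_zero_of_fibration_reads₄ [CompleteSpace E] [IsDiscreteValuationRing 𝒪[E]] [Finite 𝓀[E]]
    (σ : E →+* E) (hσ : ∀ a, σ (σ a) = a) (hvσ : ∀ a, Valued.v (σ a) = Valued.v a)
    {ϖ : E} (hϖ : Valued.v ϖ = WithZero.exp (-1 : ℤ)) {d t : ℕ} (hD : IsRamifiedQuadraticDatum σ ϖ d t) (h2v : Valued.v (2 : E) < 1)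
    {H₂ : Matrix (Fin 2) (Fin 2) E} (hH₂σ : (H₂.map σ)ᵀ = H₂) {hW : E} (hhW : Valued.v hW = 1) (hhWσ : σ hW = hW) (jE : E →+* M)
    (hρρ : ∀ x, ρ (ρ x) = x) (hvρ : ∀ x, Valued.v (ρ x) = Valued.v x) (hα : ρ α ≠ α) (hα1 : Valued.v α ≤ 1)
    (hint : ∀ z : M, Valued.v z ≤ 1 → Valued.v ((z - ρ z) / (α - ρ α)) ≤ 1)
    (hΘΘ : ∀ x, Θ (Θ x) = x) (hΘρ : ∀ x, Θ (ρ x) = ρ (Θ x)) (hvΘ : ∀ x, Valued.v (Θ x) = Valued.v x) (hΘj : ∀ x, Θ (jE x) = jE (σ x))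
    (hjv : ∀ c, Valued.v (jE c) ≤ 1 ↔ Valued.v c ≤ 1) (hjfix : ∀ z, ρ z = z ↔ ∃ c, jE c = z)
    (hjpow : ∀ (t : E) (n : ℤ), Valued.v (jE t) = Valued.v (jE ϖ) ^ n ↔ Valued.v t = Valued.v ϖ ^ n)
    (hϖmax : ∀ t : M, ρ t = t → Valued.v t < 1 → Valued.v t ≤ Valued.v (jE ϖ))
    (φ : (Fin 2 → E) →+ M) (hφs : ∀ (c : E) (x : Fin 2 → E), φ (c • x) = jE c * φ x) (hφi : Function.Injective φ) (hφo : Function.Surjective φ)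
    {γ₂ : GL (Fin 2) E} {lam h : M} (hφγ : ∀ x, φ ((γ₂ : Matrix (Fin 2) (Fin 2) E).mulVec x) = lam * φ x) (hlam : Valued.v lam = 1)
    (hΘh : Θ h = h) (hh : h ≠ 0) (hform : ∀ x y, jE (pairing σ H₂ x y) = h * Θ (φ x) * φ y + ρ (h * Θ (φ x) * φ y))
    (u : E) {b : ℕ} (hb : 1 ≤ b) (hdb : d ≤ b) {j : ℕ} (hlamj : IsOrd ρ α (jE ϖ ^ j) lam)
    (f : ℕ → ℕ → AddSubgroup M → ℕ)
    (hf : ∀ (b j : ℕ) (Λ : AddSubgroup M) (x₀ : M) (r : E), 1 ≤ b → x₀ ≠ 0 →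
      (∀ x, x ∈ Λ ↔ ∃ z, IsOrd ρ α (jE ϖ ^ j) z ∧ x = x₀ * z) →
      IsOrd ρ α (jE ϖ ^ j) (dualGen ρ Θ α (jE ϖ ^ j) h x₀) → ¬ IsOrd ρ α (jE ϖ ^ j) (dualGen ρ Θ α (jE ϖ ^ j) h x₀ / jE ϖ) →
      Valued.v (dualGen ρ Θ α (jE ϖ ^ j) h x₀) = Valued.v (jE ϖ) ^ b →
      (∀ b', (∀ x ∈ Λ, Valued.v (h * Θ x * b' + ρ (h * Θ x * b')) ≤ 1) → (lam - jE u) * b' ∈ Λ) →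
      IsOrd ρ α (jE ϖ ^ j) lam → jE r = glueUnit ρ Θ α (jE ϖ ^ j) h (jE ϖ) (jE hW) x₀ b →
      f b j Λ = Nat.card {x : 𝒪[E] ⧸ 𝓂[E] ^ (2 * b) // ∃ u' : 𝒪[E], Ideal.Quotient.mk (𝓂[E] ^ (2 * b)) u' = x ∧
        Valued.v ((u' : E) * σ u' - r) ≤ Valued.v (ϖ ^ (2 * b))})
    -- the cell letters
    (hjiso : ∀ a, Valued.v (jE a) = Valued.v a)
    (hfin : (levelSet ρ Θ α (jE ϖ) h j b).Finite)
    -- the fibration letters of ★ p863197 §1, in the consumer's currency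
    (CLS : M → Prop) (Vf : M → M) (ε : Prop) (r : ℤᵐ⁰)
    (Rd : Finset E) (hRd2 : ∀ V : E, σ V = V → Valued.v V ≤ 1 → ∃ V₀ ∈ Rd, Valued.v (V - V₀) ≤ r)
    (hRd3 : ∀ V ∈ Rd, ∀ V' ∈ Rd, Valued.v (V - V') ≤ r → V = V')
    (LIT NX ψ : E → Prop) [DecidablePred LIT] [DecidablePred NX] [DecidablePred ψ]
    (hI : ∀ (Λ : AddSubgroup M) (x₀ x₀' : M), (x₀ ≠ 0 ∧ (∀ x, x ∈ Λ ↔ ∃ ζ, IsOrd ρ α (jE ϖ ^ j) ζ ∧ x = x₀ * ζ) ∧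
        IsOrd ρ α (jE ϖ ^ j) (dualGen ρ Θ α (jE ϖ ^ j) h x₀) ∧ ¬ IsOrd ρ α (jE ϖ ^ j) (dualGen ρ Θ α (jE ϖ ^ j) h x₀ / jE ϖ) ∧
        Valued.v (dualGen ρ Θ α (jE ϖ ^ j) h x₀) = Valued.v (jE ϖ) ^ b ∧
        (∀ b', (∀ x ∈ Λ, Valued.v (h * Θ x * b' + ρ (h * Θ x * b')) ≤ 1) → (lam - jE u) * b' ∈ Λ)) → (x₀' ≠ 0 ∧ (∀ x, x ∈ Λ ↔ ∃ ζ, IsOrd ρ α (jE ϖ ^ j) ζ ∧ x = x₀' * ζ) ∧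
        IsOrd ρ α (jE ϖ ^ j) (dualGen ρ Θ α (jE ϖ ^ j) h x₀') ∧ ¬ IsOrd ρ α (jE ϖ ^ j) (dualGen ρ Θ α (jE ϖ ^ j) h x₀' / jE ϖ) ∧
        Valued.v (dualGen ρ Θ α (jE ϖ ^ j) h x₀') = Valued.v (jE ϖ) ^ b ∧
        (∀ b', (∀ x ∈ Λ, Valued.v (h * Θ x * b' + ρ (h * Θ x * b')) ≤ 1) → (lam - jE u) * b' ∈ Λ)) → (CLS x₀ ↔ CLS x₀') ∧ Valued.v (Vf x₀' - Vf x₀) ≤ r)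
    (hV : ∀ (Λ : AddSubgroup M) (x₀ : M), (x₀ ≠ 0 ∧ (∀ x, x ∈ Λ ↔ ∃ ζ, IsOrd ρ α (jE ϖ ^ j) ζ ∧ x = x₀ * ζ) ∧
        IsOrd ρ α (jE ϖ ^ j) (dualGen ρ Θ α (jE ϖ ^ j) h x₀) ∧ ¬ IsOrd ρ α (jE ϖ ^ j) (dualGen ρ Θ α (jE ϖ ^ j) h x₀ / jE ϖ) ∧
        Valued.v (dualGen ρ Θ α (jE ϖ ^ j) h x₀) = Valued.v (jE ϖ) ^ b ∧
        (∀ b', (∀ x ∈ Λ, Valued.v (h * Θ x * b' + ρ (h * Θ x * b')) ≤ 1) → (lam - jE u) * b' ∈ Λ)) → ∃ Ve : E, jE Ve = Vf x₀ ∧ σ Ve = Ve ∧ Valued.v Ve ≤ 1)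
    (hLit : ∀ (Λ : AddSubgroup M) (x₀ : M) (V₀ : E), (x₀ ≠ 0 ∧ (∀ x, x ∈ Λ ↔ ∃ ζ, IsOrd ρ α (jE ϖ ^ j) ζ ∧ x = x₀ * ζ) ∧
        IsOrd ρ α (jE ϖ ^ j) (dualGen ρ Θ α (jE ϖ ^ j) h x₀) ∧ ¬ IsOrd ρ α (jE ϖ ^ j) (dualGen ρ Θ α (jE ϖ ^ j) h x₀ / jE ϖ) ∧
        Valued.v (dualGen ρ Θ α (jE ϖ ^ j) h x₀) = Valued.v (jE ϖ) ^ b ∧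
        (∀ b', (∀ x ∈ Λ, Valued.v (h * Θ x * b' + ρ (h * Θ x * b')) ≤ 1) → (lam - jE u) * b' ∈ Λ)) → V₀ ∈ Rd → Valued.v (Vf x₀ - jE V₀) ≤ r → LIT V₀)
    (hNX : ∀ Ve V₀ : E, σ Ve = Ve → Valued.v Ve ≤ 1 → V₀ ∈ Rd → Valued.v (Ve - V₀) ≤ r → (NX Ve ↔ NX V₀))
    (hψ : ∀ Ve V₀ : E, σ Ve = Ve → Valued.v Ve ≤ 1 → V₀ ∈ Rd → Valued.v (Ve - V₀) ≤ r → (ψ Ve ↔ ψ V₀))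
    (hF : ∀ y ∈ Rd.filter LIT, ∀ y' ∈ Rd.filter LIT,
      {Λ : AddSubgroup M | ∃ x₀, (x₀ ≠ 0 ∧ (∀ x, x ∈ Λ ↔ ∃ ζ, IsOrd ρ α (jE ϖ ^ j) ζ ∧ x = x₀ * ζ) ∧
        IsOrd ρ α (jE ϖ ^ j) (dualGen ρ Θ α (jE ϖ ^ j) h x₀) ∧ ¬ IsOrd ρ α (jE ϖ ^ j) (dualGen ρ Θ α (jE ϖ ^ j) h x₀ / jE ϖ) ∧
        Valued.v (dualGen ρ Θ α (jE ϖ ^ j) h x₀) = Valued.v (jE ϖ) ^ b ∧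
        (∀ b', (∀ x ∈ Λ, Valued.v (h * Θ x * b' + ρ (h * Θ x * b')) ≤ 1) → (lam - jE u) * b' ∈ Λ)) ∧ (CLS x₀ ↔ ε) ∧ Valued.v (Vf x₀ - jE y) ≤ r}.ncard =
        {Λ : AddSubgroup M | ∃ x₀, (x₀ ≠ 0 ∧ (∀ x, x ∈ Λ ↔ ∃ ζ, IsOrd ρ α (jE ϖ ^ j) ζ ∧ x = x₀ * ζ) ∧
        IsOrd ρ α (jE ϖ ^ j) (dualGen ρ Θ α (jE ϖ ^ j) h x₀) ∧ ¬ IsOrd ρ α (jE ϖ ^ j) (dualGen ρ Θ α (jE ϖ ^ j) h x₀ / jE ϖ) ∧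
        Valued.v (dualGen ρ Θ α (jE ϖ ^ j) h x₀) = Valued.v (jE ϖ) ^ b ∧
        (∀ b', (∀ x ∈ Λ, Valued.v (h * Θ x * b' + ρ (h * Θ x * b')) ≤ 1) → (lam - jE u) * b' ∈ Λ)) ∧ (CLS x₀ ↔ ε) ∧ Valued.v (Vf x₀ - jE y') ≤ r}.ncard)
    (hbase : (((Rd.filter LIT).filter NX).filter ψ).card = (((Rd.filter LIT).filter NX).filter fun V => ¬ ψ V).card)
    -- the cell predicates and the three reads
    (P₁ Q₁ : AddSubgroup M → Prop)
    (hP : ∀ (Λ : AddSubgroup M) (x₀ : M), (x₀ ≠ 0 ∧ (∀ x, x ∈ Λ ↔ ∃ ζ, IsOrd ρ α (jE ϖ ^ j) ζ ∧ x = x₀ * ζ) ∧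
        IsOrd ρ α (jE ϖ ^ j) (dualGen ρ Θ α (jE ϖ ^ j) h x₀) ∧ ¬ IsOrd ρ α (jE ϖ ^ j) (dualGen ρ Θ α (jE ϖ ^ j) h x₀ / jE ϖ) ∧
        Valued.v (dualGen ρ Θ α (jE ϖ ^ j) h x₀) = Valued.v (jE ϖ) ^ b ∧
        (∀ b', (∀ x ∈ Λ, Valued.v (h * Θ x * b' + ρ (h * Θ x * b')) ≤ 1) → (lam - jE u) * b' ∈ Λ)) → (f b j Λ ≠ 0 ↔ (CLS x₀ ↔ ε)))
    (hL₁ : ∀ (Λ : AddSubgroup M) (x₀ : M), (x₀ ≠ 0 ∧ (∀ x, x ∈ Λ ↔ ∃ ζ, IsOrd ρ α (jE ϖ ^ j) ζ ∧ x = x₀ * ζ) ∧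
        IsOrd ρ α (jE ϖ ^ j) (dualGen ρ Θ α (jE ϖ ^ j) h x₀) ∧ ¬ IsOrd ρ α (jE ϖ ^ j) (dualGen ρ Θ α (jE ϖ ^ j) h x₀ / jE ϖ) ∧
        Valued.v (dualGen ρ Θ α (jE ϖ ^ j) h x₀) = Valued.v (jE ϖ) ^ b ∧
        (∀ b', (∀ x ∈ Λ, Valued.v (h * Θ x * b' + ρ (h * Θ x * b')) ≤ 1) → (lam - jE u) * b' ∈ Λ)) → f b j Λ ≠ 0 → (P₁ Λ ↔ ∃ Ve : E, jE Ve = Vf x₀ ∧ NX Ve ∧ ψ Ve))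
    (hL₂ : ∀ (Λ : AddSubgroup M) (x₀ : M), (x₀ ≠ 0 ∧ (∀ x, x ∈ Λ ↔ ∃ ζ, IsOrd ρ α (jE ϖ ^ j) ζ ∧ x = x₀ * ζ) ∧
        IsOrd ρ α (jE ϖ ^ j) (dualGen ρ Θ α (jE ϖ ^ j) h x₀) ∧ ¬ IsOrd ρ α (jE ϖ ^ j) (dualGen ρ Θ α (jE ϖ ^ j) h x₀ / jE ϖ) ∧
        Valued.v (dualGen ρ Θ α (jE ϖ ^ j) h x₀) = Valued.v (jE ϖ) ^ b ∧
        (∀ b', (∀ x ∈ Λ, Valued.v (h * Θ x * b' + ρ (h * Θ x * b')) ≤ 1) → (lam - jE u) * b' ∈ Λ)) → f b j Λ ≠ 0 → (Q₁ Λ ↔ ∃ Ve : E, jE Ve = Vf x₀ ∧ NX Ve ∧ ¬ ψ Ve)) :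
    ((∑ᶠ Λ ∈ levelSetDep ρ Θ α (jE ϖ) h j b (lam - jE u) ∩ {Λ | P₁ Λ}, f b j Λ : ℕ) : ℤ) -
      ((∑ᶠ Λ ∈ levelSetDep ρ Θ α (jE ϖ) h j b (lam - jE u) ∩ {Λ | Q₁ Λ}, f b j Λ : ℕ) : ℤ) = 0 := by
  rw [sub_eq_zero, Nat.cast_inj]
  refine (finsum_levelSetDep_inter_weight_eq_iff_of_le σ hσ hvσ hϖ hD h2v hH₂σ hhW hhWσ jE hρρ hvρ hα hα1 hint hΘΘ hΘρ hvΘ hΘj hjv hjfix hjpow hϖmax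
    φ hφs hφi hφo hφγ hlam hΘh hh hform u hb hdb hlamj f hf P₁ Q₁).2 ?_
  -- the two populated labelled parts are ★ p863833 §1's sets over the six-conjunct generator data (no `hcell`: ★ DEFS `mem_levelSetDep_iff` on the nose)
  have hsep : ∀ (P : AddSubgroup M → Prop) (φ' : E → Prop),
      (∀ (Λ : AddSubgroup M) (x₀ : M), (x₀ ≠ 0 ∧ (∀ x, x ∈ Λ ↔ ∃ ζ, IsOrd ρ α (jE ϖ ^ j) ζ ∧ x = x₀ * ζ) ∧
        IsOrd ρ α (jE ϖ ^ j) (dualGen ρ Θ α (jE ϖ ^ j) h x₀) ∧ ¬ IsOrd ρ α (jE ϖ ^ j) (dualGen ρ Θ α (jE ϖ ^ j) h x₀ / jE ϖ) ∧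
        Valued.v (dualGen ρ Θ α (jE ϖ ^ j) h x₀) = Valued.v (jE ϖ) ^ b ∧
        (∀ b', (∀ x ∈ Λ, Valued.v (h * Θ x * b' + ρ (h * Θ x * b')) ≤ 1) → (lam - jE u) * b' ∈ Λ)) → f b j Λ ≠ 0 → (P Λ ↔ ∃ Ve : E, jE Ve = Vf x₀ ∧ φ' Ve)) →
      {Λ ∈ levelSetDep ρ Θ α (jE ϖ) h j b (lam - jE u) | P Λ ∧ f b j Λ ≠ 0} =
        {Λ : AddSubgroup M | ∃ x₀ : M, (x₀ ≠ 0 ∧ (∀ x, x ∈ Λ ↔ ∃ ζ, IsOrd ρ α (jE ϖ ^ j) ζ ∧ x = x₀ * ζ) ∧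
        IsOrd ρ α (jE ϖ ^ j) (dualGen ρ Θ α (jE ϖ ^ j) h x₀) ∧ ¬ IsOrd ρ α (jE ϖ ^ j) (dualGen ρ Θ α (jE ϖ ^ j) h x₀ / jE ϖ) ∧
        Valued.v (dualGen ρ Θ α (jE ϖ ^ j) h x₀) = Valued.v (jE ϖ) ^ b ∧
        (∀ b', (∀ x ∈ Λ, Valued.v (h * Θ x * b' + ρ (h * Θ x * b')) ≤ 1) → (lam - jE u) * b' ∈ Λ)) ∧ (CLS x₀ ↔ ε) ∧ ∃ Ve : E, jE Ve = Vf x₀ ∧ φ' Ve} := by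
    intro P φ' hL
    ext Λ
    rw [Set.mem_sep_iff, mem_levelSetDep_iff, mem_levelSet_iff, Set.mem_setOf_eq]
    constructor
    · rintro ⟨⟨⟨x₀, hx₀, hΛ, hyO, hyp, hylev⟩, hdep⟩, hPΛ, hw⟩
      have hG : (x₀ ≠ 0 ∧ (∀ x, x ∈ Λ ↔ ∃ ζ, IsOrd ρ α (jE ϖ ^ j) ζ ∧ x = x₀ * ζ) ∧
        IsOrd ρ α (jE ϖ ^ j) (dualGen ρ Θ α (jE ϖ ^ j) h x₀) ∧ ¬ IsOrd ρ α (jE ϖ ^ j) (dualGen ρ Θ α (jE ϖ ^ j) h x₀ / jE ϖ) ∧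
        Valued.v (dualGen ρ Θ α (jE ϖ ^ j) h x₀) = Valued.v (jE ϖ) ^ b ∧
        (∀ b', (∀ x ∈ Λ, Valued.v (h * Θ x * b' + ρ (h * Θ x * b')) ≤ 1) → (lam - jE u) * b' ∈ Λ)) := ⟨hx₀, hΛ, hyO, hyp, hylev, hdep⟩
      exact ⟨x₀, hG, (hP Λ x₀ hG).1 hw, (hL Λ x₀ hG hw).1 hPΛ⟩
    · rintro ⟨x₀, hG, hC, hVe⟩
      have hw : f b j Λ ≠ 0 := (hP Λ x₀ hG).2 hC
      obtain ⟨hx₀, hΛ, hyO, hyp, hylev, hdep⟩ := hG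
      exact ⟨⟨⟨x₀, hx₀, hΛ, hyO, hyp, hylev⟩, hdep⟩, (hL Λ x₀ ⟨hx₀, hΛ, hyO, hyp, hylev, hdep⟩ hw).2 hVe, hw⟩
  rw [hsep P₁ (fun V => NX V ∧ ψ V) hL₁, hsep Q₁ (fun V => NX V ∧ ¬ ψ V) hL₂]
  have hbase' : ((Rd.filter LIT).filter fun V => NX V ∧ ψ V).card = ((Rd.filter LIT).filter fun V => NX V ∧ ¬ ψ V).card := by
    rw [← Finset.filter_filter, ← Finset.filter_filter]; exact hbase
  -- finiteness of the six-conjunct family: a subfamily of `levelSet(j, b)`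
  have hfin' : {Λ : AddSubgroup M | ∃ x₀ : M, (x₀ ≠ 0 ∧ (∀ x, x ∈ Λ ↔ ∃ ζ, IsOrd ρ α (jE ϖ ^ j) ζ ∧ x = x₀ * ζ) ∧
        IsOrd ρ α (jE ϖ ^ j) (dualGen ρ Θ α (jE ϖ ^ j) h x₀) ∧ ¬ IsOrd ρ α (jE ϖ ^ j) (dualGen ρ Θ α (jE ϖ ^ j) h x₀ / jE ϖ) ∧
        Valued.v (dualGen ρ Θ α (jE ϖ ^ j) h x₀) = Valued.v (jE ϖ) ^ b ∧
        (∀ b', (∀ x ∈ Λ, Valued.v (h * Θ x * b' + ρ (h * Θ x * b')) ≤ 1) → (lam - jE u) * b' ∈ Λ))}.Finite := by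
    refine hfin.subset ?_
    rintro Λ ⟨x₀, hx₀, hΛ, hyO, hyp, hylev, -⟩
    exact (mem_levelSet_iff ρ Θ α (jE ϖ) h j b Λ).2 ⟨x₀, hx₀, hΛ, hyO, hyp, hylev⟩
  exact ncard_eq_ncard_of_digit_fibration₂ (X := AddSubgroup M)
    (fun (Λ : AddSubgroup M) (x₀ : M) => (x₀ ≠ 0 ∧ (∀ x, x ∈ Λ ↔ ∃ ζ, IsOrd ρ α (jE ϖ ^ j) ζ ∧ x = x₀ * ζ) ∧
        IsOrd ρ α (jE ϖ ^ j) (dualGen ρ Θ α (jE ϖ ^ j) h x₀) ∧ ¬ IsOrd ρ α (jE ϖ ^ j) (dualGen ρ Θ α (jE ϖ ^ j) h x₀ / jE ϖ) ∧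
        Valued.v (dualGen ρ Θ α (jE ϖ ^ j) h x₀) = Valued.v (jE ϖ) ^ b ∧
        (∀ b', (∀ x ∈ Λ, Valued.v (h * Θ x * b' + ρ (h * Θ x * b')) ≤ 1) → (lam - jE u) * b' ∈ Λ)))
    CLS Vf ε jE hjiso r Rd hRd2 hRd3 LIT (fun V => NX V ∧ ψ V) (fun V => NX V ∧ ¬ ψ V) hI hV hLit
    (fun Ve V₀ h1 h2 h3 h4 => and_congr (hNX Ve V₀ h1 h2 h3 h4) (hψ Ve V₀ h1 h2 h3 h4))
    (fun Ve V₀ h1 h2 h3 h4 => and_congr (hNX Ve V₀ h1 h2 h3 h4) (not_congr (hψ Ve V₀ h1 h2 h3 h4))) hF hfin' hbase'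

end Summit.HodgeConjecture.HodgeConjecture.Cruxes.H413.F0P3cDyRamConeCellCountSocketDep

end
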